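import Summits.CriticalPhenomena.Ising3DConformalLimit.Theses.PositivityBegetsConformality
import Summits.CriticalPhenomena.Ising3DConformalLimit.Theorems.ExistsScaleCovariantLimit.Negative.DeltaDetermined
import Summits.CriticalPhenomena.Ising3DConformalLimit.Theorems.InversionPositiveLimit.Negative.RedundantNormalisation
import Literature.Probability.LatticeModels.InversionPositivity
import Literature.Probability.LatticeModels.PointwiseScalingLimitScale
import Literature.Probability.LatticeModels.CriticalScalingDimension
import HarnessLib

/-!
# `InversionPositiveLimit` (stmt-CriticalPhenomena-4671) is decided by ONE witness limit
(line lead c6 of crux stmt-4671, line `registered`; `--supports stmt-CriticalPhenomena-4671`)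

The crux `PositivityBegetsConformality.InversionPositiveLimit` quantifies over ALL admissible triples
`(ρ, Δ, S)` — renormalisation `ρ > 0` on `(0,1]`, dimension `Δ`, and a normalised, non-degenerate,
translation-invariant, `Δ`-scale-covariant pointwise scaling limit `S` of `criticalCorr 3` — and asks that each
be inversion positive (`IsInversionPositive Δ S`, radial Osterwalder–Schrader positivity with weight `Δ`).
The universal quantifier carries no difficulty: two non-degenerate pointwise limits of the same lattice family
differ by `cⁿ` on non-coincident configurations (`HasPointwiseScalingLimit.exists_scale_of_isNondegenerateTwoPoint`),
their dimensions agree (`delta_unique`), inversion positivity only evaluates `S` on non-coincident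
configurations (`isInversionPositive_congr_nonCoincident`) and is invariant under the arity rescaling
`S n ↦ cⁿ S n` (`IsInversionPositive.pow_mul`).  Hence:

* `isInversionPositive_transport` — inversion positivity passes from one non-degenerate scale-covariant
  pointwise limit of `criticalCorr 3` to every other (any renormalisations);
* `inversionPositiveLimit_iff_of_witness` — given ONE admissible triple `(ρ₀, Δ₀, S₀)`, the crux is
  equivalent to `IsInversionPositive Δ₀ S₀`;
* `inversionPositiveLimit_iff_exists` — the crux is equivalent to the implication
  `ExistsScaleCovariantLimit → ∃ admissible (ρ, Δ, S) with IsInversionPositive Δ S`: to close item 4671 it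
  suffices to exhibit a SINGLE inversion-positive admissible scaling limit of the critical `ℤ³` Ising
  correlators under ANY renormalisation (and if no admissible limit exists the crux holds vacuously).

No `sorry`, no definitions; information for the planners (the crux is an `∃`-statement given item 1981).
-/

noncomputable section

open Literature.Probability.LatticeModels EuclideanGeometry

namespace Summit.CriticalPhenomena.Ising3DConformalLimit.InversionPositiveLimitWitness

open Summit.CriticalPhenomena.Ising3DConformalLimit.ExistsScaleCovariantLimitNegative (delta_unique)
open Summit.CriticalPhenomena.Ising3DConformalLimit.InversionPositiveLimitNegative
  (isInversionPositive_congr_nonCoincident)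

/-- **Transport of inversion positivity along the orbit of limits.** If `S` and `S'` are non-degenerate
pointwise scaling limits of `criticalCorr 3` under renormalisations `ρ, ρ' > 0` on `(0,1]`, scale covariant with
dimensions `Δ, Δ'`, and `S` is inversion positive with weight `Δ`, then `S'` is inversion positive with weight
`Δ'`: indeed `Δ' = Δ` (`delta_unique`) and `S' = cⁿ S` on non-coincident configurations for some `c > 0`
(`exists_scale_of_isNondegenerateTwoPoint`), while `IsInversionPositive` is invariant under `S n ↦ cⁿ S n`
(`IsInversionPositive.pow_mul`) and only sees non-coincident configurations. [folklore] -/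
theorem isInversionPositive_transport {ρ ρ' : ℝ → ℝ} {Δ Δ' : ℝ} {S S' : CorrFamily 3}
    (hρ : ∀ δ ∈ Set.Ioc (0:ℝ) 1, 0 < ρ δ) (hlim : HasPointwiseScalingLimit (criticalCorr 3) ρ S)
    (hnd : IsNondegenerateTwoPoint S) (hsc : IsScaleCovariant Δ S)
    (hρ' : ∀ δ ∈ Set.Ioc (0:ℝ) 1, 0 < ρ' δ) (hlim' : HasPointwiseScalingLimit (criticalCorr 3) ρ' S')
    (hnd' : IsNondegenerateTwoPoint S') (hsc' : IsScaleCovariant Δ' S')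
    (hIP : IsInversionPositive Δ S) : IsInversionPositive Δ' S' := by
  obtain ⟨c, _, hscale⟩ :=
    hlim.exists_scale_of_isNondegenerateTwoPoint (by norm_num) hρ hρ' hlim' hnd hnd'
  have hΔ : Δ = Δ' := delta_unique hρ hlim hnd hsc hρ' hlim' hnd' hsc'
  subst hΔ
  have h1 : IsInversionPositive Δ (fun n x => c ^ n * S n x) := hIP.pow_mul c
  exact (isInversionPositive_congr_nonCoincident (S := fun n x => c ^ n * S n x) (T := S')
    (fun n z hz => (hscale n z hz).symm)).1 h1

/-- **The crux is decided by one witness.** Given ONE admissible triple `(ρ₀, Δ₀, S₀)` (the hypotheses of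
`InversionPositiveLimit`), the crux holds if and only if THAT limit is inversion positive with weight `Δ₀`.
[folklore] -/
theorem inversionPositiveLimit_iff_of_witness {ρ₀ : ℝ → ℝ} {Δ₀ : ℝ} {S₀ : CorrFamily 3}
    (hρ₀ : ∀ δ ∈ Set.Ioc (0:ℝ) 1, 0 < ρ₀ δ) (hlim₀ : HasPointwiseScalingLimit (criticalCorr 3) ρ₀ S₀)
    (hnorm₀ : ∀ n z, z ∉ NonCoincident 3 n → S₀ n z = 0) (hnd₀ : IsNondegenerateTwoPoint S₀)
    (htr₀ : IsTranslationInvariant S₀) (hsc₀ : IsScaleCovariant Δ₀ S₀) :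
    Summit.CriticalPhenomena.Ising3DConformalLimit.Theses.PositivityBegetsConformality.InversionPositiveLimit ↔
      IsInversionPositive Δ₀ S₀ := by
  constructor
  · intro h
    exact h ρ₀ Δ₀ S₀ hρ₀ hlim₀ hnorm₀ hnd₀ htr₀ hsc₀
  · intro hIP ρ Δ S hρ hlim _ hnd _ hsc
    exact isInversionPositive_transport hρ₀ hlim₀ hnd₀ hsc₀ hρ hlim hnd hsc hIP

/-- **`∃`-form of the crux.** `InversionPositiveLimit` is equivalent to: IF the critical `ℤ³` Ising
correlators have a normalised, non-degenerate, translation-invariant, scale-covariant pointwise limit at all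
(item stmt-1981 `ExistsScaleCovariantLimit`, route spelling), THEN some admissible triple is inversion positive.
(`⇐`: any admissible `(ρ, Δ, S)` has `Δ ∈ [1/2, 1]` by `scalingDimension_mem_Icc_holds`, so it witnesses item
1981; transport from the inversion-positive witness.) [folklore] -/
theorem inversionPositiveLimit_iff_exists : Summit.CriticalPhenomena.Ising3DConformalLimit.Theses.PositivityBegetsConformality.InversionPositiveLimit ↔ (Summit.CriticalPhenomena.Ising3DConformalLimit.Theses.PositivityBegetsConformality.ExistsScaleCovariantLimit → ∃ (ρ : ℝ → ℝ) (Δ : ℝ) (S : Literature.Probability.LatticeModels.CorrFamily 3), (∀ δ ∈ Set.Ioc (0:ℝ) 1, 0 < ρ δ) ∧ Literature.Probability.LatticeModels.HasPointwiseScalingLimit (Literature.Probability.LatticeModels.criticalCorr 3) ρ S ∧ (∀ n z, z ∉ Literature.Probability.LatticeModels.NonCoincident 3 n → S n z = 0) ∧ Literature.Probability.LatticeModels.IsNondegenerateTwoPoint S ∧ Literature.Probability.LatticeModels.IsTranslationInvariant S ∧ Literature.Probability.LatticeModels.IsScaleCovariant Δ S ∧ Literature.Probability.LatticeModels.IsInversionPositive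 Δ S) := by
  constructor
  · rintro h ⟨ρ, Δ, S, hρ, _, hlim, hnorm, hnd, htr, hsc⟩
    exact ⟨ρ, Δ, S, hρ, hlim, hnorm, hnd, htr, hsc, h ρ Δ S hρ hlim hnorm hnd htr hsc⟩
  · intro h ρ Δ S hρ hlim hnorm hnd htr hsc
    have hΔ : Δ ∈ Set.Icc (1 / 2 : ℝ) 1 := scalingDimension_mem_Icc_holds ρ Δ S hlim hsc hnd hρ
    have hΔpos : 0 < Δ := lt_of_lt_of_le (by norm_num) hΔ.1
    obtain ⟨ρ₁, Δ₁, S₁, hρ₁, hlim₁, _, hnd₁, _, hsc₁, hIP₁⟩ :=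
      h ⟨ρ, Δ, S, hρ, hΔpos, hlim, hnorm, hnd, htr, hsc⟩
    exact isInversionPositive_transport hρ₁ hlim₁ hnd₁ hsc₁ hρ hlim hnd hsc hIP₁

/-- **Vacuous branch, recorded.** If the critical `ℤ³` Ising correlators have NO admissible pointwise limit
(`¬ ExistsScaleCovariantLimit`), the crux holds (there is nothing to check). [folklore] -/
theorem inversionPositiveLimit_of_not_exists
    (h : ¬ Summit.CriticalPhenomena.Ising3DConformalLimit.Theses.PositivityBegetsConformality.ExistsScaleCovariantLimit) :
    Summit.CriticalPhenomena.Ising3DConformalLimit.Theses.PositivityBegetsConformality.InversionPositiveLimit :=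
  inversionPositiveLimit_iff_exists.2 fun hE => absurd hE h

end Summit.CriticalPhenomena.Ising3DConformalLimit.InversionPositiveLimitWitness

end
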